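import Literature.AnabelianGeometry.EtaleTheta.TemperedFrobenioidCor38SubPreStepsPartners
import HarnessLib

/-!
# [EtTh] Cor. 3.8 proof row C38-L02a `PreservesPreSteps` (F-2809): MONICITY OF THE BASE DESCENDS for linear
# morphisms — the "monic endomorphisms" hypothesis of the partnered closers is superfluous

S. Mochizuki, *The étale theta function and its Frobenioid-theoretic manifestations*, Publ. RIMS **45** (2009)
[EtTh], Cor. 3.8, proof, PDF p. 81 l. 2–3 ("by [Mzk17], Theorem 3.4, (ii) … it follows that `Ψ` preserves
pre-steps") [cite: MochizukiEtTh2009, Cor 3.8 p.81]; S. Mochizuki, *The geometry of Frobenioids I*, Kyushu J. Math.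
**62** (2008) [FrdI], §0 p. 14 (FSM-morphisms), pp. 17–18 (FSMFF-type), Def. 1.2 (iii) p. 22 (pre-steps), Thm. 5.2 (i)
p. 100 (model Frobenioids) [cite: MochizukiFrdI2008, Thm. 5.2(i) p.100].

abc-iut cell, block C / W6, seat abc-iut-w6-d079 (gen 5).  PROOF-ONLY file (0 definitions), a further HAND for the
decision on the bare universal closure of `Cor38Hyp.PreservesPreSteps` (FACT-LIST F-2809), on top of
abc-iut-w6-d057's `TemperedFrobenioidCor38SubPreStepsBaseFS.lean` (the base of the image of a pre-step is
FIBERWISE-SURJECTIVE) and abc-iut-f-109's `TemperedFrobenioidCor38SubPreStepsPartners.lean` (partnered pre-steps go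
to pre-steps "provided the endomorphisms in the target base are monomorphisms").

WHAT IS PROVED (model Frobenioid of ANY data `(D, Φ, B, B → Φ^gp)`, no hypothesis unless named in the signature).
* **`ModelFrobenioid.mono_baseMap_of_mono_of_degFr_eq_one`** — MONICITY DESCENDS IN DEGREE ONE: if a LINEAR morphism
  `φ = (1, f, Z, u) : (X, α) → (Y, β)` is a monomorphism of the model Frobenioid, then `f = Base(φ)` is a monomorphism
  of `D`.  (Hypothesis-free: for `a, a' : W → X` with `a ≫ f = a' ≫ f` the two lifts `(1, a, a'^*Z, a'^*u)`,
  `(1, a', a^*Z, a^*u)` out of the common object `(W, a^*α · Div_B(a'^*u) · (a'^*Z)⁻¹)` have the same composite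
  with `φ`.)  In degree `d ≥ 2` this fails in general (the lifts would need `d`-th roots), which is why the
  statement is about linear morphisms.
* **`ModelFrobenioid.mono_of_degFr_eq_one_of_mono_baseMap`** — conversely a linear morphism over a monic base arrow is
  a monomorphism as soon as the divisor monoids are cancellative and `B` is group-like (the units cancel).
* Hence, for EVERY record `h : Cor38Hyp C₁ C₂` between typed tempered Frobenioids with CANCELLATIVE divisor monoids
  (every constructed record of the cell: free / `ℕ` / `ℚ_{≥0}` / `ℝ_{≥0}`-valued divisors):
  **`Cor38Hyp.mono_baseMap_map_of_isPreStep_of_isLinear`** — the base of a LINEAR image of a pre-step is a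
  monomorphism, hence (abc-iut-w6-d057) an FSM-morphism of `D₂`;
  **`Cor38Hyp.isBaseIso_map_of_partner'`**, **`Cor38Hyp.isPreStep_map_of_partner'`** (+ the `Ψ⁻¹` mirrors) and
  **`Cor38Hyp.preservesPreSteps_of_partners'`**, **`Cor38Hyp.preservesPreSteps_of_cofinal'`** — abc-iut-f-109's
  partnered closers of row C38-L02a WITHOUT their hypothesis "endomorphisms in `D₁`, `D₂` are monomorphisms": over
  ARBITRARY (connected, totally epimorphic, FSMFF) bases, `Ψ` and `Ψ⁻¹` preserve every partnered pre-step, in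
  particular all pre-steps when the principal divisors are cofinal on both sides.
READING (cell rule R5; FACT-LIST label of F-2809 NOT moved: conditional / instance PROVED / bare closure open):
the room for a separating record shrinks once more — the image of a pre-step `φ` is linear as soon as `φ` has a
partner (abc-iut-f-109), and a LINEAR image lies over an FSM arrow of `D₂` (fiberwise-surjective by abc-iut-w6-d057,
monic by this file); so a separating `h` must move a PARTNER-LESS pre-step, and move it EITHER to a morphism of
Frobenius degree `≥ 2` OR to a linear morphism over a non-invertible FSM arrow between two DISTINCT objects of `D₂`
(an arrow with a finite FSMI-factorisation, [FrdI] §0 p. 17); non-monic base arrows (e.g. the fiberwise-surjective,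
non-monic, non-invertible `h` of the FSMFF monoid `S ⋊_ψ ℕ`, `ψ` a non-injective surjective endomorphism of a free
monoid `S` on infinitely many letters) can NO LONGER carry a linear image.  No [FrdI] Thm. 3.4 input; no Frobenioid
axiom; vocabulary clauses untouched.
HONEST FRAMING: bookkeeping about OUR typed Def. 3.6 interface (print's Cor. 3.8 quotes [FrdI] Thm. 3.4 (ii) for
genuine Frobenioids); nothing here bears on [IUTchIII] Cor. 3.12; no side taken; typed ≠ proved.
-/

namespace Literature.AlgebraicGeometry.Frobenioids

open CategoryTheory Opposite

namespace ModelFrobenioid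

universe u v w

variable {D : Type u} [Category.{v} D] {Φ B : Dᵒᵖ ⥤ CommMonCat.{w}} {DivB : B ⟶ monoidGp Φ}

/-- A bookkeeping identity in a commutative group (the source classes of the two lifts agree). [folklore] -/
private theorem lift_rel_aux {G : Type w} [CommGroup G] {P Pa Pa' za za' dua dua' : G}
    (ha : Pa * za = P * dua) (ha' : Pa' * za' = P * dua') :
    Pa * dua' * za'⁻¹ * za = Pa' * dua := by
  have e1 : Pa = P * dua * za⁻¹ := eq_mul_inv_of_mul_eq ha
  have e2 : Pa' = P * dua' * za'⁻¹ := eq_mul_inv_of_mul_eq ha'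
  rw [e1, e2]
  calc P * dua * za⁻¹ * dua' * za'⁻¹ * za = P * dua * dua' * za'⁻¹ * (za⁻¹ * za) := by ac_rfl
    _ = P * dua * dua' * za'⁻¹ := by rw [inv_mul_cancel, mul_one]
    _ = P * dua' * za'⁻¹ * dua := by ac_rfl

/-- **Monicity of the base DESCENDS in Frobenius degree one** ([FrdI] Thm. 5.2 (i) data, no hypothesis): if the
linear morphism `φ = (1, f, Z, u)` of the model Frobenioid is a monomorphism, then so is `f = Base(φ)` in `D` — two
base arrows `a, a' : W → X` equalised by `f` lift to the morphisms `(1, a, a'^*Z, a'^*u)`, `(1, a', a^*Z, a^*u)` out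
of one object over `W`, which `φ` equalises. [cite: MochizukiFrdI2008, Thm. 5.2(i) p.100] -/
theorem mono_baseMap_of_mono_of_degFr_eq_one {X Y : ModelFrobenioid Φ B DivB} (φ : X ⟶ Y) [Mono φ]
    (hd : degFr φ = 1) : Mono (baseMap φ) := by
  refine ⟨fun {W} a a' haa' => ?_⟩
  -- the pulled-back data
  set za : Φ.obj (op W) := (Φ.map a.op).hom (div φ) with hza
  set za' : Φ.obj (op W) := (Φ.map a'.op).hom (div φ) with hza'
  set ua : B.obj (op W) := (B.map a.op).hom (unit φ) with hua
  set ua' : B.obj (op W) := (B.map a'.op).hom (unit φ) with hua'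
  -- the relation of `φ` and its two pull-backs
  have hrel : X.cls * Algebra.GrothendieckGroup.of (div φ) =
      pullGp Φ (baseMap φ) Y.cls * divB Φ B DivB _ (unit φ) := by
    have h := rel φ
    rwa [hd, PNat.one_coe, pow_one] at h
  have ha : pullGp Φ a X.cls * Algebra.GrothendieckGroup.of za =
      pullGp Φ (a ≫ baseMap φ) Y.cls * divB Φ B DivB _ ua := by
    have h := congrArg (pullGp Φ a) hrel
    rwa [map_mul, map_mul, pullGp_of, pullGp_divB, ← pullGp_comp] at h
  have ha' : pullGp Φ a' X.cls * Algebra.GrothendieckGroup.of za' =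
      pullGp Φ (a' ≫ baseMap φ) Y.cls * divB Φ B DivB _ ua' := by
    have h := congrArg (pullGp Φ a') hrel
    rwa [map_mul, map_mul, pullGp_of, pullGp_divB, ← pullGp_comp] at h
  rw [← haa'] at ha'
  -- the common source object and the two lifts
  set ω : Algebra.GrothendieckGroup (Φ.obj (op W)) :=
    pullGp Φ a X.cls * divB Φ B DivB _ ua' * (Algebra.GrothendieckGroup.of za')⁻¹ with hω
  let V : ModelFrobenioid Φ B DivB := ⟨W, ω⟩
  let δ : V ⟶ X :=
    { degFr := 1, base := a, div := za', unit := ua'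
      rel := by
        show ω ^ ((1 : ℕ+) : ℕ) * Algebra.GrothendieckGroup.of za' = pullGp Φ a X.cls * divB Φ B DivB _ ua'
        rw [PNat.one_coe, pow_one, hω, inv_mul_cancel_right] }
  let δ' : V ⟶ X :=
    { degFr := 1, base := a', div := za, unit := ua
      rel := by
        show ω ^ ((1 : ℕ+) : ℕ) * Algebra.GrothendieckGroup.of za = pullGp Φ a' X.cls * divB Φ B DivB _ ua
        rw [PNat.one_coe, pow_one, hω]
        exact lift_rel_aux ha ha' }
  have hcomp : δ ≫ φ = δ' ≫ φ := by
    apply hom_ext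
    · rfl
    · exact haa'
    · show (Φ.map a.op).hom (div φ) * za' ^ (degFr φ : ℕ) = (Φ.map a'.op).hom (div φ) * za ^ (degFr φ : ℕ)
      rw [hd, PNat.one_coe, pow_one, pow_one, ← hza, ← hza', mul_comm]
    · show (B.map a.op).hom (unit φ) * ua' ^ (degFr φ : ℕ) = (B.map a'.op).hom (unit φ) * ua ^ (degFr φ : ℕ)
      rw [hd, PNat.one_coe, pow_one, pow_one, ← hua, ← hua', mul_comm]
  have hδ : δ = δ' := (cancel_mono φ).mp hcomp
  exact congrArg Hom.base hδ

/-- Conversely: a LINEAR morphism over a monic base arrow is a monomorphism of the model Frobenioid, provided the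
divisor monoids are cancellative and `B` is group-like (the degree, the base, the divisor and the unit of a morphism
`δ` are recovered from `δ ≫ φ`). [cite: MochizukiFrdI2008, Thm. 5.2(i) p.100] -/
theorem mono_of_degFr_eq_one_of_mono_baseMap
    (hΦ : ∀ (A : Dᵒᵖ) (x y z : (Φ.obj A : Type w)), x * y = x * z → y = z)
    (hB : ∀ (A : Dᵒᵖ) (b : (B.obj A : Type w)), IsUnit b)
    {X Y : ModelFrobenioid Φ B DivB} (φ : X ⟶ Y) (hd : degFr φ = 1) [Mono (baseMap φ)] : Mono φ := by
  refine ⟨fun {W} δ δ' hδ => ?_⟩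
  have h₁ : degFr δ = degFr δ' := by
    have h := congrArg degFr hδ
    rw [degFr_comp, degFr_comp, hd, one_mul, one_mul] at h
    exact h
  have h₂ : baseMap δ = baseMap δ' := by
    have h := congrArg baseMap hδ
    rw [baseMap_comp, baseMap_comp] at h
    exact (cancel_mono (baseMap φ)).mp h
  apply hom_ext h₁ h₂
  · have h := congrArg div hδ
    rw [div_comp, div_comp, hd, PNat.one_coe, pow_one, pow_one, h₂] at h
    exact hΦ _ _ _ _ h
  · have h := congrArg unit hδ
    rw [unit_comp, unit_comp, hd, PNat.one_coe, pow_one, pow_one, h₂] at h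
    exact (hB _ _).mul_left_cancel h

end ModelFrobenioid

end Literature.AlgebraicGeometry.Frobenioids

/-! ## The row C38-L02a over the typed Def. 3.6 interface: partnered pre-steps over ARBITRARY bases -/

namespace Literature.AnabelianGeometry.EtaleTheta

open CategoryTheory Opposite Literature.AlgebraicGeometry.Frobenioids

universe u₀ v₀ u v w

variable {D₀ : Type u₀} [Category.{v₀} D₀] {V : FrdIMonoidStub.{w}} {T : RealifiedDivisorMonoids (D₀ := D₀) V}
  {D : Type u} [Category.{v} D] {VD : FrdICatStub.{u, v, w} D}

namespace TemperedFrobenioid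

/-- Over a typed tempered Frobenioid with CANCELLATIVE divisor monoids, every linear morphism over a monic base
arrow — in particular every pre-step, and every element of `O^▷(−)·O^×(−)` — is a monomorphism of the Frobenioid
(`B = B₀^Λ|_D ×_{(Φ^{ℝ-log})^gp} Φ^gp` is group-like by Def. 3.6 (i)). [cite: MochizukiEtTh2009, Def 3.6 p.77] -/
theorem mono_of_degFr_eq_one (C : TemperedFrobenioid T D VD)
    (hΦ : ∀ (A : Dᵒᵖ) (x y z : C.Φ.carrier A), x * y = x * z → y = z)
    {X Y : C.category} (φ : X ⟶ Y) (hd : ModelFrobenioid.degFr φ = 1)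
    [Mono (ModelFrobenioid.baseMap φ)] : Mono φ :=
  ModelFrobenioid.mono_of_degFr_eq_one_of_mono_baseMap hΦ
    (fun _ b => C.isUnit_ratFn (T.isUnit_BΛ _) b) φ hd

end TemperedFrobenioid

section Rows

variable {D₀' : Type u₀} [Category.{v₀} D₀'] {T' : RealifiedDivisorMonoids (D₀ := D₀') V}
  {D' : Type u} [Category.{v} D'] {VD' : FrdICatStub.{u, v, w} D'}
  {C₁ : TemperedFrobenioid T D VD} {C₂ : TemperedFrobenioid T' D' VD'}

namespace Cor38Hyp

variable (h : Cor38Hyp C₁ C₂)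

/-- An equivalence carries monomorphisms to monomorphisms (bookkeeping). [cite: MochizukiEtTh2009, Cor 3.8 p.81] -/
theorem mono_map_of_mono {X Y : C₁.category} (φ : X ⟶ Y) [Mono φ] : Mono (h.Ψ.functor.map φ) :=
  inferInstance

/-- The mirror for `Ψ⁻¹`. [cite: MochizukiEtTh2009, Cor 3.8 p.81] -/
theorem mono_inverse_map_of_mono {X Y : C₂.category} (φ : X ⟶ Y) [Mono φ] : Mono (h.Ψ.inverse.map φ) :=
  inferInstance

/-- **For EVERY record `h`**: if the divisor monoids of `C₁` are cancellative, the base of a LINEAR image of a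
pre-step of `C₁` is a MONOMORPHISM of `D₂` (hence, with abc-iut-w6-d057, an FSM-morphism of `D₂`).
[cite: MochizukiEtTh2009, Cor 3.8 p.81] -/
theorem mono_baseMap_map_of_isPreStep_of_isLinear
    (hΦ : ∀ (A : Dᵒᵖ) (x y z : C₁.Φ.carrier A), x * y = x * z → y = z)
    {X Y : C₁.category} (φ : X ⟶ Y) (hφ : C₁.opsData.IsPreStep φ)
    (hlin : C₂.opsData.IsLinear (h.Ψ.functor.map φ)) :
    Mono (ModelFrobenioid.baseMap (h.Ψ.functor.map φ)) := by
  have hφ' := (C₁.opsData_isPreStep_iff φ).1 hφ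
  haveI : IsIso (ModelFrobenioid.baseMap φ) := hφ'.2
  haveI : Mono φ := C₁.mono_of_degFr_eq_one hΦ φ hφ'.1
  haveI : Mono (h.Ψ.functor.map φ) := h.mono_map_of_mono φ
  exact ModelFrobenioid.mono_baseMap_of_mono_of_degFr_eq_one _ hlin

/-- The FSM form: for every record, the base of a linear image of a pre-step is an FSM-morphism of `D₂`
(fiberwise-surjective: abc-iut-w6-d057; monic: this file). [cite: MochizukiEtTh2009, Cor 3.8 p.81] -/
theorem isFSM_baseMap_map_of_isPreStep_of_isLinear
    (hΦ : ∀ (A : Dᵒᵖ) (x y z : C₁.Φ.carrier A), x * y = x * z → y = z)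
    {X Y : C₁.category} (φ : X ⟶ Y) (hφ : C₁.opsData.IsPreStep φ)
    (hlin : C₂.opsData.IsLinear (h.Ψ.functor.map φ)) :
    IsFSM (ModelFrobenioid.baseMap (h.Ψ.functor.map φ)) :=
  ⟨h.isFiberwiseSurjective_baseMap_map_of_isPreStep φ hφ, h.mono_baseMap_map_of_isPreStep_of_isLinear hΦ φ hφ hlin⟩

/-- **Base half for partnered pre-steps over an ARBITRARY base, USING `Cor38Hyp.fsmff`**: abc-iut-f-109's
`isBaseIso_map_of_partner` without its hypothesis "endomorphisms of `Base(Ψ X)` are monomorphisms" — the one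
endomorphism that matters, `Base(Ψ(ψ ∘ φ))`, is monic by degree-one mono descent. [cite: MochizukiEtTh2009, Cor 3.8 p.81] -/
theorem isBaseIso_map_of_partner'
    (hΦ : ∀ (A : Dᵒᵖ) (x y z : C₁.Φ.carrier A), x * y = x * z → y = z)
    {X Y : C₁.category} (φ : X ⟶ Y) (ψ : Y ⟶ X)
    (hφ : C₁.opsData.IsPreStep φ) (hψ : C₁.opsData.IsPreStep ψ)
    (hb : ModelFrobenioid.baseMap (φ ≫ ψ) = 𝟙 X.base) :
    IsIso (ModelFrobenioid.baseMap (h.Ψ.functor.map φ)) := by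
  have hφ' := (C₁.opsData_isPreStep_iff φ).1 hφ
  have hψ' := (C₁.opsData_isPreStep_iff ψ).1 hψ
  have hpre : C₁.opsData.IsPreStep (φ ≫ ψ) := by
    refine (C₁.opsData_isPreStep_iff _).2 ⟨?_, ?_⟩
    · rw [ModelFrobenioid.degFr_comp, hφ'.1, hψ'.1, mul_one]
    · rw [hb]
      infer_instance
  have hlin : C₂.opsData.IsLinear (h.Ψ.functor.map (φ ≫ ψ)) :=
    h.isLinear_map_of_mem_endSubmonoid_all (C₁.comp_mem_endSubmonoid φ ψ hφ'.1 hψ'.1 hb)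
  have hFSM := h.isFSM_baseMap_map_of_isPreStep_of_isLinear hΦ (φ ≫ ψ) hpre hlin
  rw [h.Ψ.functor.map_comp, ModelFrobenioid.baseMap_comp] at hFSM
  haveI : IsIso (ModelFrobenioid.baseMap (h.Ψ.functor.map φ) ≫ ModelFrobenioid.baseMap (h.Ψ.functor.map ψ)) :=
    h.fsmff.2.isIso_of_isFSM_of_isEndomorphism _ hFSM
  exact (C₂.isTotallyEpimorphic.isIso_of_isIso_comp (ModelFrobenioid.baseMap (h.Ψ.functor.map φ))
    (ModelFrobenioid.baseMap (h.Ψ.functor.map ψ))).2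

/-- The mirror for `Ψ⁻¹` (cancellative divisor monoids on `C₂`). [cite: MochizukiEtTh2009, Cor 3.8 p.81] -/
theorem isBaseIso_inverse_map_of_partner'
    (hΦ' : ∀ (A : D'ᵒᵖ) (x y z : C₂.Φ.carrier A), x * y = x * z → y = z)
    {X Y : C₂.category} (φ : X ⟶ Y) (ψ : Y ⟶ X)
    (hφ : C₂.opsData.IsPreStep φ) (hψ : C₂.opsData.IsPreStep ψ)
    (hb : ModelFrobenioid.baseMap (φ ≫ ψ) = 𝟙 X.base) :
    IsIso (ModelFrobenioid.baseMap (h.Ψ.inverse.map φ)) := by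
  have hφ' := (C₂.opsData_isPreStep_iff φ).1 hφ
  have hψ' := (C₂.opsData_isPreStep_iff ψ).1 hψ
  have hpre : C₂.opsData.IsPreStep (φ ≫ ψ) := by
    refine (C₂.opsData_isPreStep_iff _).2 ⟨?_, ?_⟩
    · rw [ModelFrobenioid.degFr_comp, hφ'.1, hψ'.1, mul_one]
    · rw [hb]
      infer_instance
  have hlin : C₁.opsData.IsLinear (h.Ψ.inverse.map (φ ≫ ψ)) :=
    h.isLinear_inverse_map_of_mem_endSubmonoid_all (C₂.comp_mem_endSubmonoid φ ψ hφ'.1 hψ'.1 hb)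
  have hFS := h.isFiberwiseSurjective_baseMap_inverse_map_of_isPreStep (φ ≫ ψ) hpre
  haveI : IsIso (ModelFrobenioid.baseMap (φ ≫ ψ)) := ((C₂.opsData_isPreStep_iff _).1 hpre).2
  haveI : Mono (φ ≫ ψ) := C₂.mono_of_degFr_eq_one hΦ' (φ ≫ ψ) ((C₂.opsData_isPreStep_iff _).1 hpre).1
  haveI : Mono (h.Ψ.inverse.map (φ ≫ ψ)) := h.mono_inverse_map_of_mono (φ ≫ ψ)
  have hM : Mono (ModelFrobenioid.baseMap (h.Ψ.inverse.map (φ ≫ ψ))) :=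
    ModelFrobenioid.mono_baseMap_of_mono_of_degFr_eq_one _ hlin
  rw [h.Ψ.inverse.map_comp, ModelFrobenioid.baseMap_comp] at hFS hM
  haveI : IsIso (ModelFrobenioid.baseMap (h.Ψ.inverse.map φ) ≫ ModelFrobenioid.baseMap (h.Ψ.inverse.map ψ)) :=
    h.fsmff.1.isIso_of_isFSM_of_isEndomorphism _ ⟨hFS, hM⟩
  exact (C₁.isTotallyEpimorphic.isIso_of_isIso_comp (ModelFrobenioid.baseMap (h.Ψ.inverse.map φ))
    (ModelFrobenioid.baseMap (h.Ψ.inverse.map ψ))).2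

/-- **`Ψ` carries every PARTNERED pre-step to a pre-step, for EVERY record and over an ARBITRARY target base**
(cancellative divisor monoids on `C₁`). [cite: MochizukiEtTh2009, Cor 3.8 p.81] -/
theorem isPreStep_map_of_partner'
    (hΦ : ∀ (A : Dᵒᵖ) (x y z : C₁.Φ.carrier A), x * y = x * z → y = z)
    {X Y : C₁.category} (φ : X ⟶ Y) (ψ : Y ⟶ X)
    (hφ : C₁.opsData.IsPreStep φ) (hψ : C₁.opsData.IsPreStep ψ)
    (hb : ModelFrobenioid.baseMap (φ ≫ ψ) = 𝟙 X.base) :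
    C₂.opsData.IsPreStep (h.Ψ.functor.map φ) :=
  ⟨h.isLinear_map_of_partner φ ψ hφ.1 hψ.1 hb, h.isBaseIso_map_of_partner' hΦ φ ψ hφ hψ hb⟩

/-- The mirror for `Ψ⁻¹`. [cite: MochizukiEtTh2009, Cor 3.8 p.81] -/
theorem isPreStep_inverse_map_of_partner'
    (hΦ' : ∀ (A : D'ᵒᵖ) (x y z : C₂.Φ.carrier A), x * y = x * z → y = z)
    {X Y : C₂.category} (φ : X ⟶ Y) (ψ : Y ⟶ X)
    (hφ : C₂.opsData.IsPreStep φ) (hψ : C₂.opsData.IsPreStep ψ)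
    (hb : ModelFrobenioid.baseMap (φ ≫ ψ) = 𝟙 X.base) :
    C₁.opsData.IsPreStep (h.Ψ.inverse.map φ) :=
  ⟨h.isLinear_inverse_map_of_partner φ ψ hφ.1 hψ.1 hb, h.isBaseIso_inverse_map_of_partner' hΦ' φ ψ hφ hψ hb⟩

/-- **Row C38-L02a (F-2809) on the partnered class, for EVERY record, over ARBITRARY (FSMFF, totally epimorphic)
bases**: abc-iut-f-109's `preservesPreSteps_of_partners` without the "monic endomorphisms" hypotheses, assuming only
cancellative divisor monoids. [cite: MochizukiEtTh2009, Cor 3.8 p.81] -/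
theorem preservesPreSteps_of_partners'
    (hΦ : ∀ (A : Dᵒᵖ) (x y z : C₁.Φ.carrier A), x * y = x * z → y = z)
    (hΦ' : ∀ (A : D'ᵒᵖ) (x y z : C₂.Φ.carrier A), x * y = x * z → y = z)
    (hP₁ : ∀ ⦃X Y : C₁.category⦄ (φ : X ⟶ Y), C₁.opsData.IsPreStep φ →
      ∃ ψ : Y ⟶ X, C₁.opsData.IsPreStep ψ ∧ ModelFrobenioid.baseMap (φ ≫ ψ) = 𝟙 X.base)
    (hP₂ : ∀ ⦃X Y : C₂.category⦄ (φ : X ⟶ Y), C₂.opsData.IsPreStep φ →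
      ∃ ψ : Y ⟶ X, C₂.opsData.IsPreStep ψ ∧ ModelFrobenioid.baseMap (φ ≫ ψ) = 𝟙 X.base) :
    h.PreservesPreSteps := by
  refine ⟨fun X Y φ hφ => ?_, fun X Y φ hφ => ?_⟩
  · obtain ⟨ψ, hψ, hb⟩ := hP₁ φ hφ
    exact h.isPreStep_map_of_partner' hΦ φ ψ hφ hψ hb
  · obtain ⟨ψ, hψ, hb⟩ := hP₂ φ hφ
    exact h.isPreStep_inverse_map_of_partner' hΦ' φ ψ hφ hψ hb

/-- **Row C38-L02a (F-2809) from COFINAL principal divisors, for EVERY record, over ARBITRARY bases** (cancellative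
divisor monoids). [cite: MochizukiEtTh2009, Cor 3.8 p.81] -/
theorem preservesPreSteps_of_cofinal'
    (hΦ : ∀ (A : Dᵒᵖ) (x y z : C₁.Φ.carrier A), x * y = x * z → y = z)
    (hΦ' : ∀ (A : D'ᵒᵖ) (x y z : C₂.Φ.carrier A), x * y = x * z → y = z)
    (hcof₁ : ∀ (A : Dᵒᵖ) (g : Algebra.GrothendieckGroup (C₁.Φ.carrier A)),
      ∃ (u : C₁.ratFn A) (m : C₁.Φ.carrier A), C₁.divB A u = g * Algebra.GrothendieckGroup.of m)
    (hcof₂ : ∀ (A : D'ᵒᵖ) (g : Algebra.GrothendieckGroup (C₂.Φ.carrier A)),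
      ∃ (u : C₂.ratFn A) (m : C₂.Φ.carrier A), C₂.divB A u = g * Algebra.GrothendieckGroup.of m) :
    h.PreservesPreSteps :=
  h.preservesPreSteps_of_partners' hΦ hΦ'
    (fun _ _ φ hφ => C₁.exists_partner_of_cofinal (C₁.cofinal_model_of_cofinal hcof₁) φ hφ)
    (fun _ _ φ hφ => C₂.exists_partner_of_cofinal (C₂.cofinal_model_of_cofinal hcof₂) φ hφ)

end Cor38Hyp

end Rows

end Literature.AnabelianGeometry.EtaleTheta
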